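import Literature.NumberTheory.QuadraticForms.HilbertSymbolUnramifiedClassSub   -- ★ p857408 (this lineage): `hilbertSymbol_self_neg`, `hilbertSymbol_mul_sq_right_of_ne_zero`, and the consumer `hilbertSymbol_sub_eq_one_iff_of_unramifiedClass`
import HarnessLib

/-!
# The UNRAMIFIED CLASS read from a model: `(y, a)_F = 1 ⟺ v(y)` even, whenever `a·c²` is the square of an anti-invariant element `𝔩` of an unramified
# quadratic `F ⊕ F𝔩` inside a bigger valued field (unit norms surjective, values of `F ⊕ F𝔩` of even valuation)

Topic `NumberTheory/QuadraticForms`; namespace `Literature.NumberTheory.QuadraticForms`.  THEOREMS ONLY (no definition, no instance, no notation, no named fact, no `sorry`).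
Field-general: `F`, `M` valued fields, `j : F →+* M` with `|j y| = |y|²` (the composite of a ramified and an unramified quadratic step), `ρ` an isometric endomorphism of `M`
fixing `j(F)`, `𝔩 ∈ M` with `ρ𝔩 = −𝔩`.  HYPOTHESES ON THE «DESCENT LINE» `K := j(F) ⊕ j(F)·𝔩`: (hKev) its non-zero elements have EVEN `log`-valuation in `M`; (hKnorm) every UNIT of `F`
is a norm `(jA + jB𝔩)(jA − jB𝔩)` — Serre's `N(U_K) = U_F` for an unramified quadratic extension.  CONCLUSION (`hilbertSymbol_eq_one_iff_even_of_unramifiedModel`): if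
`j(a·c²) = 𝔩²` (`c ≠ 0`) then for every `y ≠ 0`
  `(y, a)_F = 1 ⟺ log |y|_F` is even,
i.e. `a` is of UNRAMIFIED CLASS in the sense of ★ `hilbertSymbol_sub_eq_one_iff_of_unramifiedClass` (its hypothesis `hA`).  Proof: `(y, a) = (y, ac²)`; if `y p² + ac²q² = 1`
with `p ≠ 0` then `j(y)·j(p)² = (1 + j q·𝔩)(1 − j q·𝔩) = N(1 + jq𝔩)` has `log`-valuation `≡ 0 (mod 4)`, so `log|y|` is even (`p = 0` is impossible: `𝔩` would be `ρ`-fixed);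
conversely an even `y` is `y₀·ϖ^{2k}` with `y₀ = N(A + B𝔩) = A² − ac²B²` a unit norm, and `y₀∕A² + ac²(B∕A)² = 1` (or `(−ac², ac²) = 1` when `A = 0`).
USE (crux H413, Track A «(D-RAM) FOUR-FRAME», (ρ2b′-X) organ O-Sign, LH4-p13 (g5)): the `hA`-BRIDGE of ★ `F0P3cDyRamTokenSignUnr.hilbertSymbol_token_eq_one_iff_even` — `F := L⁺_v`,
`M :=` the one-field model of `E·K_γ`, `j := jE ∘ ι_w`, `ρ := Gal(M∕L_w)`, `𝔩 := λ′ − ρλ′` (`𝔩² = a(a + 4)`, `a + 4 ∈ F²` deep), type U = `K_γ∕F` unramified (hKev, hKnorm).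
HONEST LABEL: count-neutral helper (`--supports stmt-HodgeConjecture-24833`); HC_CM is proved only modulo the 7 printed citations (2 remaining named inputs: hLiu418 =
stmt-HodgeConjecture-24832, h413 = stmt-HodgeConjecture-24833) until rung 0 closes.

## References
* [Serre1979] J.-P. Serre, *Local Fields*, GTM 67 (1979), Ch. V §2 Prop. 3 (unramified: `N(U_L) = U_K`), Ch. XIV §3 (`(a, b) = 1 ⟺ a ∈ N K(√b)`).
* [Omeara1963] O. T. O'Meara, *Introduction to Quadratic Forms*, Grundlehren 117 (1963), §63B 63:10, §63C Example 63:16 (unramified norms = even order).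
-/

set_option autoImplicit false

noncomputable section

open WithZero

namespace Literature.NumberTheory.QuadraticForms

/-- **THE UNRAMIFIED CLASS READ FROM A MODEL.**  `j : F → M` with `|j y| = |y|²`, `ρ` isometric on `M` fixing `j(F)`, `ρ𝔩 = −𝔩`, `2 ≠ 0` in `M`; the line `j(F) ⊕ j(F)𝔩` has non-zero elements of
even `log`-valuation (hKev) and represents every unit of `F` as a norm `(jA + jB𝔩)(jA − jB𝔩)` (hKnorm); `|ϖ_F| = exp(−1)`; `j(a·c²) = 𝔩²`, `c ≠ 0`.  Then for `y ≠ 0`: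
**`(y, a)_F = 1 ⟺ log|y|_F` is even.** [cite: Serre1979, Ch. V §2 Prop. 3; Ch. XIV §3] [cite: Omeara1963, §63C Example 63:16] -/
theorem hilbertSymbol_eq_one_iff_even_of_unramifiedModel {F M : Type*} [Field F] [Field M] [Valued F ℤᵐ⁰] [Valued M ℤᵐ⁰] [NeZero (2 : F)]
    (j : F →+* M) (hjv : ∀ y, Valued.v (j y) = Valued.v y ^ 2)
    {ρ : M →+* M} (hρv : ∀ z, Valued.v (ρ z) = Valued.v z) (hρj : ∀ y, ρ (j y) = j y)
    {l : M} (hρl : ρ l = -l) (h2M : (2 : M) ≠ 0)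
    (hKev : ∀ A B : F, j A + j B * l ≠ 0 → Even (log (Valued.v (j A + j B * l))))
    (hKnorm : ∀ y : F, Valued.v y = 1 → ∃ A B : F, j y = (j A + j B * l) * (j A - j B * l))
    {ϖF : F} (hϖF : Valued.v ϖF = exp (-1 : ℤ))
    {a c : F} (hc : c ≠ 0) (hac : j (a * c ^ 2) = l ^ 2) {y : F} (hy : y ≠ 0) :
    hilbertSymbol F y a = 1 ↔ Even (log (Valued.v y)) := by
  have hj : Function.Injective j := j.injective
  have hϖ0 : ϖF ≠ 0 := fun h => by rw [h, map_zero] at hϖF; exact exp_ne_zero hϖF.symm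
  rw [← hilbertSymbol_mul_sq_right_of_ne_zero y a hc]
  constructor
  · -- `(y, ac²) = 1 ⇒ log|y|` even
    intro h
    obtain ⟨p, q, hpq⟩ := (hilbertSymbol_eq_one_iff _ _).1 h
    rcases eq_or_ne p 0 with rfl | hp
    · -- `p = 0`: `ac²q² = 1`, so `(𝔩·jq)² = 1`, `𝔩·jq = ±1` would be `ρ`-fixed and anti-fixed
      exfalso
      have h1 : (l * j q) ^ 2 = 1 := by
        have h' := congrArg j hpq
        rw [map_add, map_mul, map_mul, map_pow, map_zero, zero_pow two_ne_zero, mul_zero, zero_add, map_pow, map_one, hac] at h'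
        rw [← h']; ring
      have hρx : ρ (l * j q) = -(l * j q) := by rw [map_mul, hρl, hρj]; ring
      have hx1 : l * j q = 1 ∨ l * j q = -1 := by
        have h' : (l * j q - 1) * (l * j q + 1) = 0 := by linear_combination h1
        rcases mul_eq_zero.1 h' with h' | h'
        · exact Or.inl (sub_eq_zero.1 h')
        · exact Or.inr (eq_neg_of_add_eq_zero_left h')
      have h2x : 2 * (l * j q) = 0 := by
        rcases hx1 with hx | hx
        · have h' := hρx; rw [hx, map_one] at h'; linear_combination 2 * hx + h'
        · have h' := hρx; rw [hx, map_neg, map_one] at h'; linear_combination 2 * hx + h'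
      rcases mul_eq_zero.1 h2x with h' | h'
      · exact h2M h'
      · rcases hx1 with hx | hx <;> rw [h'] at hx <;> norm_num at hx
    · -- `p ≠ 0`: `j y · (j p)² = N(1 + jq·𝔩)`
      have hN : j y * j p ^ 2 = (1 + j q * l) * (1 - j q * l) := by
        have h' := congrArg j hpq
        simp only [map_add, map_mul, map_pow, map_one] at h'
        have hl2 : j a * j c ^ 2 = l ^ 2 := by rw [← hac, map_mul, map_pow]
        linear_combination h' - (j q) ^ 2 * hl2
      have hz0 : 1 + j q * l ≠ 0 := fun h0 => by
        have h' := hN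
        rw [h0, zero_mul, mul_eq_zero] at h'
        rcases h' with h' | h'
        · exact hy (hj (by rw [h', map_zero]))
        · exact hp (hj (by rw [map_zero]; exact pow_eq_zero_iff two_ne_zero |>.1 h'))
      have hρz : ρ (1 + j q * l) = 1 - j q * l := by rw [map_add, map_one, map_mul, hρj, hρl]; ring
      have hval : Valued.v y ^ 2 * (Valued.v p ^ 2) ^ 2 = Valued.v (1 + j q * l) ^ 2 := by
        rw [← hjv, ← hjv, ← Valuation.map_pow, ← Valuation.map_mul, hN, Valuation.map_mul, ← hρz, hρv, sq]
      have hvy0 : Valued.v y ≠ 0 := (Valuation.ne_zero_iff _).2 hy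
      have hvp0 : Valued.v p ≠ 0 := (Valuation.ne_zero_iff _).2 hp
      have hvz0 : Valued.v (1 + j q * l) ≠ 0 := (Valuation.ne_zero_iff _).2 hz0
      have hlog := congrArg log hval
      rw [log_mul (pow_ne_zero _ hvy0) (pow_ne_zero _ (pow_ne_zero _ hvp0)), log_pow, log_pow, log_pow, log_pow] at hlog
      simp only [nsmul_eq_mul, Nat.cast_ofNat] at hlog
      obtain ⟨n, hn⟩ := hKev 1 q (by rwa [map_one])
      rw [map_one] at hn
      exact ⟨n - log (Valued.v p), by omega⟩
  · -- `log|y|` even ⇒ `y = y₀·(ϖ^k)²`, `y₀` a unit norm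
    rintro ⟨k, hk⟩
    set y₀ : F := y * (ϖF ^ k) ^ 2 with hy₀
    have hvy₀ : Valued.v y₀ = 1 := by
      have hvy : Valued.v y = exp (log (Valued.v y)) := (exp_log ((Valuation.ne_zero_iff _).2 hy)).symm
      rw [hy₀, Valuation.map_mul, Valuation.map_pow, map_zpow₀, hϖF, hvy, hk, ← exp_zsmul, ← exp_nsmul, ← exp_add, ← exp_zero]
      congr 1
      simp only [smul_eq_mul, nsmul_eq_mul, Nat.cast_ofNat, mul_neg, mul_one]
      ring
    have hyy₀ : y = y₀ * ((ϖF ^ k)⁻¹) ^ 2 := by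
      rw [hy₀]; field_simp
    rw [hyy₀, hilbertSymbol_mul_sq_left y₀ _ (inv_ne_zero (zpow_ne_zero k hϖ0))]
    obtain ⟨A, B, hAB⟩ := hKnorm y₀ hvy₀
    have hy₀AB : y₀ = A ^ 2 - a * c ^ 2 * B ^ 2 := by
      apply hj
      rw [hAB, map_sub, map_mul, map_pow, map_pow, hac]; ring
    have hy₀0 : y₀ ≠ 0 := fun h => by rw [h, map_zero] at hvy₀; exact zero_ne_one hvy₀
    rcases eq_or_ne A 0 with rfl | hA
    · -- `y₀ = −ac²B²`: `(−ac²·B², ac²) = (−ac², ac²) = 1`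
      have hB : B ≠ 0 := fun hB => hy₀0 (by rw [hy₀AB, hB]; ring)
      have hac0 : a * c ^ 2 ≠ 0 := fun h0 => hy₀0 (by rw [hy₀AB, h0]; ring)
      rw [hy₀AB, show (0 : F) ^ 2 - a * c ^ 2 * B ^ 2 = -(a * c ^ 2) * B ^ 2 by ring, hilbertSymbol_mul_sq_left _ _ hB,
        hilbertSymbol_comm]
      exact hilbertSymbol_self_neg hac0
    · refine (hilbertSymbol_eq_one_iff _ _).2 ⟨A⁻¹, B / A, ?_⟩
      rw [hy₀AB]
      field_simp
      ring

end Literature.NumberTheory.QuadraticForms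

end
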